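import Summits.CriticalPhenomena.PercolationContinuityZ3.Theorems.Transplant.SkelFrmFromBChoiceZone
import Summits.CriticalPhenomena.PercolationContinuityZ3.Theorems.Transplant.SkelFrmFromBChoiceZoneKPx
import HarnessLib

/-!
# GEN ROW (WAVE-Us-MANIFEST v1.0 §3/§9/§11, INPUT layer complement) «SkelFrmFromBChoiceZonePx» — the ZONE DATUM of the consumer's zone family `Λ ∘ prox` AT EVERY
# LEVEL (`M_u` and any `k ≥ D`), twin of «SkelFrmFromBChoiceZone»'s `hzconn_of_atQ` / `hcz_of_atQ` / `hczAt_of_atQ` under `HasProxies t D` (hunk classes (iii)/(iv))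

builds on p205010 (kernel theorem, internal audit signed; external expert review pending) — nothing in this file uses p205010.  The (C)/(R) consumers hand the φ-level
root/reach lemmas the zone FAMILY `fun c => Λ c M_u` with its datum `(hΛRg) (hzconn) (hcz) (hZρ)` (§11); under option (a) the family is `fun c => Λ (prox c) M_u` and
this file supplies `hzconn`/`hcz`/`hczAt`/`hZρ` for it at every level `k ≥ D` (in particular `M_u ≥ k ≥ D` under the seed floor): both the centre and the target lie in
the fat prism about `prox c` (`Λ = fatSeq` at every level by `FactsO.seed`; `pathIn_cylBall'`), the centre by the floor (`HasProxies.mem_fatSeq_prox`), the ball by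
the triangle through the proxy (`+ D`).  Level `k` versions with the kit prism are in «…ZoneKPx».  Nothing about any open node (U, U_s) is claimed.
[cite: KozmaNitzan2024, §4 pp. 19–21; §4 Lemma 12] [this work]
-/

noncomputable section

open scoped Classical

namespace Summit.CriticalPhenomena.PercolationContinuityZ3.Theorems.Transplant

open MeasureTheory Literature.Probability.Percolation Literature.Probability.LatticeModels SimpleGraph KNCells KNLevels
open Literature.Barriers.CriticalPhenomena (graphBall graphBall_mono)
open SkelConc (Consts)
open Skelφ (oriφ trφ)
open Skelφ.StepI (DataN DataNS OutNS)

namespace PlanarSkeletonFrmFrom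

namespace NegB

open Neg

section ZonePx

variable {κ : Consts} {V : Type} [DecidableEq V] [Countable V] {G : SimpleGraph V} [G.LocallyFinite] {Φ : PlanarSkeletonFrmFrom G} {t : V} {p : unitInterval}
  {hC : Φ.CylSubcritical p} {gv fv : Neg.FSlot} {Pv : PSlot} {Sv : SSlot} {cv : CSlot} {bv : BSlot} {O : OutNS V} {q : unitInterval} {D : ℕ}

/-- The zone at ANY level is the fat seed: `Λ c k = fatSeq c k` (`FactsO.seed`). [folklore] -/
theorem zoneAt_eq_fatSeq (hAt : (choiceAtQ3 κ Φ t p Pv gv fv Sv cv bv hC).AtQNQ O q) (c : V) (k : ℕ) :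
    O.merged.Λ c k = Skelφ.fatSeq Φ.frame hC c k := by
  obtain ⟨-, -, -, -, hΛeq⟩ := Skelφ.StepI.OutO.FactsO.seed hAt.1.factsO
  exact congrFun (congrFun hΛeq c) k

/-- **`hczAt` under proxies**: the centre lies in its consumer-side zone `Λ (prox c) k` at every level `k ≥ D`. [this work] -/
theorem hczAt_of_atQPx (hAt : (choiceAtQ3 κ Φ t p Pv gv fv Sv cv bv hC).AtQNQ O q) (hP : Φ.HasProxies t D) (c : V) {k : ℕ} (hk : D ≤ k) :
    c ∈ O.merged.Λ (hP.prox c) k := by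
  rw [zoneAt_eq_fatSeq hAt (hP.prox c) k]
  exact hP.mem_fatSeq_prox hC c hk

/-- **`hcz` under proxies at `M_u`** (`D ≤ M_u`). [this work] -/
theorem hcz_of_atQPx (hAt : (choiceAtQ3 κ Φ t p Pv gv fv Sv cv bv hC).AtQNQ O q) (hP : Φ.HasProxies t D) (hD : D ≤ Mu O.merged) :
    ∀ c, c ∈ O.merged.Λ (hP.prox c) (Mu O.merged) :=
  fun c => hczAt_of_atQPx hAt hP c hD

/-- **`hzconn` under proxies at every level `k ≥ D`**: the consumer-side zone is connected from the CENTRE inside itself. [this work] -/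
theorem hzconnAt_of_atQPx (hAt : (choiceAtQ3 κ Φ t p Pv gv fv Sv cv bv hC).AtQNQ O q) (hP : Φ.HasProxies t D) {k : ℕ} (hk : D ≤ k) :
    ∀ c, ∀ s ∈ O.merged.Λ (hP.prox c) k, PathIn G (↑(O.merged.Λ (hP.prox c) k) : Set V) c s := by
  intro c s hs
  have e := zoneAt_eq_fatSeq hAt (hP.prox c) k
  have eset : (↑(O.merged.Λ (hP.prox c) k) : Set V) = Skelφ.cylBall G Φ.φ (hP.prox c) k (Skelφ.fatRadius Φ.frame hC k) := by
    ext v; rw [Finset.mem_coe, e, Skelφ.mem_fatSeq_iff]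
  rw [eset]
  have hs' : s ∈ Skelφ.cylBall G Φ.φ (hP.prox c) k (Skelφ.fatRadius Φ.frame hC k) := by
    rw [e, Skelφ.mem_fatSeq_iff] at hs; exact hs
  have hc' : c ∈ Skelφ.cylBall G Φ.φ (hP.prox c) k (Skelφ.fatRadius Φ.frame hC k) := by
    have h := hczAt_of_atQPx hAt hP c hk
    rw [e, Skelφ.mem_fatSeq_iff] at h; exact h
  exact Skelφ.pathIn_cylBall' (G := G) (φ := Φ.φ) hc' hs'

/-- **`hzconn` under proxies at `M_u`** (`D ≤ M_u`). [this work] -/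
theorem hzconn_of_atQPx (hAt : (choiceAtQ3 κ Φ t p Pv gv fv Sv cv bv hC).AtQNQ O q) (hP : Φ.HasProxies t D) (hD : D ≤ Mu O.merged) :
    ∀ c, ∀ s ∈ O.merged.Λ (hP.prox c) (Mu O.merged), PathIn G (↑(O.merged.Λ (hP.prox c) (Mu O.merged)) : Set V) c s :=
  hzconnAt_of_atQPx hAt hP hD

/-- **`hZρ` under proxies at every level**: the consumer-side zone lies in `B(c, D + fatRadius k)` (triangle through the proxy; radius slot `+ D`). [this work] -/
theorem hZρAt_of_atQPx (hAt : (choiceAtQ3 κ Φ t p Pv gv fv Sv cv bv hC).AtQNQ O q) (hP : Φ.HasProxies t D) (c : V) (k : ℕ) :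
    ∀ a ∈ O.merged.Λ (hP.prox c) k, a ∈ graphBall G c (D + Skelφ.fatRadius Φ.frame hC k) := by
  intro a ha
  rw [zoneAt_eq_fatSeq hAt (hP.prox c) k, Skelφ.mem_fatSeq_iff] at ha
  exact mem_graphBall_trans (Skelφ.mem_graphBall_comm (hP.mem_graphBall_prox c)) (Skelφ.cylBall_subset_prism G Φ.φ (hP.prox c) _ _ ha).1

/-- **`hZρ` under proxies at `M_u` against the kit radius**: the consumer-side zone at `M_u` lies in `B(c, Rs + D)` (the U twin's `Λ ⊆ RgK ⊆ B(·, Rs)` at `prox c`,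
triangle through the proxy) — the root rows' `hZρ` with the radius slot `Rs ↦ Rs + D`. [this work] -/
theorem hZρ_Rs_of_atQPx (mk : ℕ) (hAt : (choiceAtQ3 κ Φ t p Pv gv fv Sv cv bv hC).AtQNQ O q) (hP : Φ.HasProxies t D) (c : V) :
    ∀ a ∈ O.merged.Λ (hP.prox c) (Mu O.merged), a ∈ graphBall G c (D + KS.Rs t O.merged mk) :=
  fun a ha => mem_graphBall_trans (Skelφ.mem_graphBall_comm (hP.mem_graphBall_prox c))
    (KS.RgK_subset_graphBall (G := G) t O.merged mk _ (hP.prox c) a (hΛRg_of_atQ mk hAt (hP.prox c) ha))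

end ZonePx

end NegB

end PlanarSkeletonFrmFrom

end Summit.CriticalPhenomena.PercolationContinuityZ3.Theorems.Transplant

end
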